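import Summits.QuantumFields.BalabanUV.Beta.GAN24.CapacitanceClosedFormScaling
import Summits.QuantumFields.BalabanUV.Beta.GAN24.ResolventDifference

/-!
# `BalabanUV.Beta.GAN24.CapacitanceRate` — binder row G-an2-4 / (CONV-C), road P1-fibre, leaf **P1-L11** `FibreRate` of `SKELETON-P1.md` (Part B), PART 1/3 of the
# «L11 CAPACITANCE HALF»: ABSTRACT TWO-LEVEL RATES of the explicit inverse-capacitance blocks from the rates of the `D + 1` scalars

NOT IN PRINT; OUR PROOF ATTEMPT.  HONEST FRAMING (cell contract, verbatim): «discharging `BetaPertH` makes Bałaban's UV stability UNCONDITIONAL — a real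
constructive-QFT result; it is NOT the continuum limit and NOT the Clay problem.»  HONEST DEPENDENCY (verbatim): «continuum YM on T⁴ ⇐ BetaPertH ∧ nine spine
estimates (0/9 proved); BetaPertH ⇐ (D1) ∧ (D4) ∧ CAP+tail; G-an2-4 gates asym, D1 and NE2/3/4.»  [folklore] finite-dimensional rational algebra over `ℂ`; no cited fact, no wall binder, no `def`, no
`def … : Prop` hypothesis, no cancellation.  NOT summit progress: it discharges NOTHING of (CONV-C)'s K-slot `GAN24.CombesThomas.ConvCK 3 Lc` by itself (this is one input of
row L11 = shape (I2′) of the carver's ASSEMBLY.md §II.3; L10 = (I3′) and L12 are separate); 0 wall binders instantiated; NOT `BetaPertH`, NOT continuum, NOT Clay.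
Unit `b2b-balaban-gan24-formalise-leaf-20` (G-an2-4 formalisation swarm, leaf prover 20), 2026-08-20.  Value = kernel assembly leaf toward the K-slot route P1,
NOT summit progress.

## What is proved
The typer's cut (LEAVES.md v2.1, row P1-Y11s, verbatim intent): «With Y08f/Y08s/E4: (Cap_{j+1}⁻¹ − Cap_j⁻¹) blockwise ≤ C θ^j × the A4′(iii) p-orders — p1's
L11 capacitance half».  The inverse blocks `invPP/invPc/invcP/invcc` of `GAN24/CapacitanceClosedForm` §5 are RATIONAL in the scalars `a_κ, σ` and
`h = hSum a δ δ'`, with the coarse symbols `δ, δ'` LEVEL-INDEPENDENT; so only the SCALAR resolvent identity is needed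
(`ResolventDifference.norm_inv_sub_inv_le`, leaf P1-L11a, BY NAME):
* §1 HOMOGENEITY under `(a, σ) ↦ (a/M, σ/M)`: `invPc/invcP/invcc (a/M) … (σ/M) = M·(invPc/invcP/invcc a … σ)` (leaf-02's `hSum_div`/`invPP_div` cover `h`, `φφ`);
* §2 ABSTRACT TWO-LEVEL RATES: for data `(a, σ)`, `(a', σ')` (all non-vanishing) with COMMON bounds `‖a_κ⁻¹‖, ‖a'_κ⁻¹‖ ≤ α`, `‖σ⁻¹‖, ‖σ'⁻¹‖ ≤ ς`,
  `‖h⁻¹‖, ‖h'⁻¹‖ ≤ η`, `‖δ_κ‖, ‖δ'_κ‖ ≤ ε` and rates `‖a'_κ − a_κ‖ ≤ ρ`, `‖σ' − σ‖ ≤ τ`: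
  `‖(a'_κ)⁻¹ − (a_κ)⁻¹‖ ≤ α²ρ`, `‖h' − h‖ ≤ D·ε²·α²ρ`, `‖h'⁻¹ − h⁻¹‖ ≤ η²·D·ε²·α²ρ`, `‖σ'⁻¹ − σ⁻¹‖ ≤ ς²τ`, and (`norm_mul3_sub_le` telescoping)
  **`‖invPP a' − invPP a‖ ≤ α²ρ + ε²(2α³ρη + Dε²α⁴ρη²)`**, **`‖invPc' − invPc‖, ‖invcP' − invcP‖ ≤ ε(α²ρςη + ας²τη + Dε²α³ρςη²)`**,
  **`‖invcc' − invcc‖ ≤ ς²τ/2 + 2ς³τη + Dε²α²ρς²η²`**.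
PART 2/3 `GAN24/CapacitanceRateDictionary` identifies leaf-12's `capDiag/capBorder/capH` with `N^{D+4}` × leaf-07's unit-normalised `aT/sT` and the scaled
endpoint `N^{D+4}·(cap N p)⁻¹`; PART 3/3 `GAN24/CapacitanceRateScaled` plugs leaf-07's `aT_rate`/`sT_rate` and displays the constants.
-/

noncomputable section

open Complex Finset
open scoped BigOperators Real

namespace Summit.QuantumFields.BalabanUV.Beta.GAN24.CapacitanceRate

open CapacitanceClosedForm (hSum invPP invPc invcP invcc)
open CapacitanceClosedFormScaling (hSum_div invPP_div)

variable {D : ℕ}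

/-! ## §1 Homogeneity of the inverse blocks under `(a, σ) ↦ (a/M, σ/M)` -/

/-- [folklore] `invPc (a/M) δ δ' (σ/M) κ = M · invPc a δ δ' σ κ` (`M ≠ 0`). -/
theorem invPc_div_div (a δ δ' : Fin D → ℂ) (σ : ℂ) {M : ℂ} (hM : M ≠ 0) (κ : Fin D) :
    invPc (fun κ => a κ / M) δ δ' (σ / M) κ = M * invPc a δ δ' σ κ := by
  unfold invPc
  rw [hSum_div, show a κ / M * (σ / M) * (M * hSum a δ δ') = (a κ * σ * hSum a δ δ') / M by field_simp]
  rw [div_div_eq_mul_div]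
  ring

/-- [folklore] `invcP (a/M) δ δ' (σ/M) l = M · invcP a δ δ' σ l` (`M ≠ 0`). -/
theorem invcP_div_div (a δ δ' : Fin D → ℂ) (σ : ℂ) {M : ℂ} (hM : M ≠ 0) (l : Fin D) :
    invcP (fun κ => a κ / M) δ δ' (σ / M) l = M * invcP a δ δ' σ l := by
  unfold invcP
  rw [hSum_div, show a l / M * (σ / M) * (M * hSum a δ δ') = (a l * σ * hSum a δ δ') / M by field_simp]
  rw [div_div_eq_mul_div]
  ring

/-- [folklore] `invcc (a/M) δ δ' (σ/M) = M · invcc a δ δ' σ` (`M, σ, hSum a ≠ 0`). -/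
theorem invcc_div_div (a δ δ' : Fin D → ℂ) {σ M : ℂ} (hM : M ≠ 0) (hσ : σ ≠ 0) (hh : hSum a δ δ' ≠ 0) :
    invcc (fun κ => a κ / M) δ δ' (σ / M) = M * invcc a δ δ' σ := by
  unfold invcc
  rw [hSum_div]
  field_simp

/-! ## §2 Abstract two-level rates of the inverse blocks -/

/-- [folklore] Scalar three-factor telescoping with bounds: `‖x'y'z' − xyz‖ ≤ dx·by·bz + bx·dy·bz + bx·by·dz`. -/
theorem norm_mul3_sub_le {x x' y y' z z' : ℂ} {bx by' bz dx dy dz : ℝ} (hx : ‖x‖ ≤ bx) (hy : ‖y‖ ≤ by') (hy' : ‖y'‖ ≤ by')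
    (hz' : ‖z'‖ ≤ bz) (hdx : ‖x' - x‖ ≤ dx) (hdy : ‖y' - y‖ ≤ dy) (hdz : ‖z' - z‖ ≤ dz) :
    ‖x' * y' * z' - x * y * z‖ ≤ dx * by' * bz + bx * dy * bz + bx * by' * dz := by
  have h0x : 0 ≤ bx := (norm_nonneg _).trans hx
  have h0y : 0 ≤ by' := (norm_nonneg _).trans hy
  have h0z : 0 ≤ bz := (norm_nonneg _).trans hz'
  have h0dx : 0 ≤ dx := (norm_nonneg _).trans hdx
  have h0dy : 0 ≤ dy := (norm_nonneg _).trans hdy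
  have e : x' * y' * z' - x * y * z = (x' - x) * y' * z' + x * (y' - y) * z' + x * y * (z' - z) := by ring
  rw [e]
  refine (norm_add₃_le).trans (add_le_add (add_le_add ?_ ?_) ?_)
  · rw [norm_mul, norm_mul]
    exact mul_le_mul (mul_le_mul hdx hy' (norm_nonneg _) h0dx) hz' (norm_nonneg _) (mul_nonneg h0dx h0y)
  · rw [norm_mul, norm_mul]
    exact mul_le_mul (mul_le_mul hx hdy (norm_nonneg _) h0x) hz' (norm_nonneg _) (mul_nonneg h0x h0dy)
  · rw [norm_mul, norm_mul]
    exact mul_le_mul (mul_le_mul hx hy (norm_nonneg _) h0x) hdz (norm_nonneg _) (mul_nonneg h0x h0y)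

section abstract
variable (a a' δ δ' : Fin D → ℂ) (σ σ' : ℂ) {α ε ς η ρ τ : ℝ}

/-- [folklore] RATE OF THE DIAGONAL INVERSES: `‖(a'_κ)⁻¹ − (a_κ)⁻¹‖ ≤ α²ρ`. -/
theorem norm_inv_sub_inv_diag_le (ha : ∀ κ, a κ ≠ 0) (ha' : ∀ κ, a' κ ≠ 0) (hα : ∀ κ, ‖(a κ)⁻¹‖ ≤ α) (hα' : ∀ κ, ‖(a' κ)⁻¹‖ ≤ α)
    (hρ : ∀ κ, ‖a' κ - a κ‖ ≤ ρ) (κ : Fin D) : ‖(a' κ)⁻¹ - (a κ)⁻¹‖ ≤ α ^ 2 * ρ := by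
  have h := ResolventDifference.norm_inv_sub_inv_le (ha' κ) (ha κ) (hα' κ) (hα κ) (hρ κ)
  calc ‖(a' κ)⁻¹ - (a κ)⁻¹‖ ≤ α * ρ * α := h
    _ = α ^ 2 * ρ := by ring

/-- [folklore] RATE OF THE SCHUR SCALAR: `‖hSum a' δ δ' − hSum a δ δ'‖ ≤ D·ε²·α²ρ` (`δ, δ'` level-independent). -/
theorem norm_hSum_sub_le (ha : ∀ κ, a κ ≠ 0) (ha' : ∀ κ, a' κ ≠ 0) (hα : ∀ κ, ‖(a κ)⁻¹‖ ≤ α) (hα' : ∀ κ, ‖(a' κ)⁻¹‖ ≤ α)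
    (hε : ∀ κ, ‖δ κ‖ ≤ ε) (hε' : ∀ κ, ‖δ' κ‖ ≤ ε) (hρ : ∀ κ, ‖a' κ - a κ‖ ≤ ρ) :
    ‖hSum a' δ δ' - hSum a δ δ'‖ ≤ D * (ε ^ 2 * (α ^ 2 * ρ)) := by
  have e : hSum a' δ δ' - hSum a δ δ' = ∑ κ, δ κ * δ' κ * ((a' κ)⁻¹ - (a κ)⁻¹) := by
    unfold hSum
    rw [← Finset.sum_sub_distrib]
    exact Finset.sum_congr rfl fun κ _ => by rw [div_eq_mul_inv, div_eq_mul_inv]; ring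
  rw [e]
  refine (norm_sum_le _ _).trans ?_
  calc ∑ κ, ‖δ κ * δ' κ * ((a' κ)⁻¹ - (a κ)⁻¹)‖ ≤ ∑ _κ : Fin D, ε ^ 2 * (α ^ 2 * ρ) := by
        refine Finset.sum_le_sum fun κ _ => ?_
        have hε0 : 0 ≤ ε := (norm_nonneg _).trans (hε κ)
        rw [norm_mul, norm_mul]
        have h2 : ‖δ κ‖ * ‖δ' κ‖ ≤ ε * ε := mul_le_mul (hε κ) (hε' κ) (norm_nonneg _) hε0
        calc ‖δ κ‖ * ‖δ' κ‖ * ‖(a' κ)⁻¹ - (a κ)⁻¹‖ ≤ ε * ε * (α ^ 2 * ρ) :=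
              mul_le_mul h2 (norm_inv_sub_inv_diag_le a a' ha ha' hα hα' hρ κ) (norm_nonneg _) (mul_nonneg hε0 hε0)
          _ = ε ^ 2 * (α ^ 2 * ρ) := by ring
    _ = D * (ε ^ 2 * (α ^ 2 * ρ)) := by simp

/-- [folklore] RATE OF THE INVERSE SCHUR SCALAR: `‖h'⁻¹ − h⁻¹‖ ≤ η²·D·ε²·α²ρ`. -/
theorem norm_inv_hSum_sub_le (ha : ∀ κ, a κ ≠ 0) (ha' : ∀ κ, a' κ ≠ 0) (hh : hSum a δ δ' ≠ 0) (hh' : hSum a' δ δ' ≠ 0)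
    (hα : ∀ κ, ‖(a κ)⁻¹‖ ≤ α) (hα' : ∀ κ, ‖(a' κ)⁻¹‖ ≤ α) (hε : ∀ κ, ‖δ κ‖ ≤ ε) (hε' : ∀ κ, ‖δ' κ‖ ≤ ε)
    (hη : ‖(hSum a δ δ')⁻¹‖ ≤ η) (hη' : ‖(hSum a' δ δ')⁻¹‖ ≤ η) (hρ : ∀ κ, ‖a' κ - a κ‖ ≤ ρ) :
    ‖(hSum a' δ δ')⁻¹ - (hSum a δ δ')⁻¹‖ ≤ η ^ 2 * (D * (ε ^ 2 * (α ^ 2 * ρ))) := by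
  have h := ResolventDifference.norm_inv_sub_inv_le hh' hh hη' hη (norm_hSum_sub_le a a' δ δ' ha ha' hα hα' hε hε' hρ)
  calc ‖(hSum a' δ δ')⁻¹ - (hSum a δ δ')⁻¹‖ ≤ η * (D * (ε ^ 2 * (α ^ 2 * ρ))) * η := h
    _ = η ^ 2 * (D * (ε ^ 2 * (α ^ 2 * ρ))) := by ring

/-- [folklore] RATE OF THE BORDER INVERSE: `‖σ'⁻¹ − σ⁻¹‖ ≤ ς²τ`. -/
theorem norm_inv_sigma_sub_le (hσ : σ ≠ 0) (hσ' : σ' ≠ 0) (hς : ‖σ⁻¹‖ ≤ ς) (hς' : ‖σ'⁻¹‖ ≤ ς) (hτ : ‖σ' - σ‖ ≤ τ) :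
    ‖σ'⁻¹ - σ⁻¹‖ ≤ ς ^ 2 * τ := by
  have h := ResolventDifference.norm_inv_sub_inv_le hσ' hσ hς' hς hτ
  calc ‖σ'⁻¹ - σ⁻¹‖ ≤ ς * τ * ς := h
    _ = ς ^ 2 * τ := by ring

/-- [folklore] The `φφ` block in product-of-inverses form. -/
theorem invPP_eq_inv (a δ δ' : Fin D → ℂ) (κ l : Fin D) :
    invPP a δ δ' κ l = (if κ = l then (a κ)⁻¹ else 0) - δ κ * δ' l * ((a κ)⁻¹ * (a l)⁻¹ * (hSum a δ δ')⁻¹) := by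
  unfold invPP
  rw [one_div, div_eq_mul_inv, mul_inv, mul_inv]

/-- [folklore] The `φc` column in product-of-inverses form. -/
theorem invPc_eq_inv (a δ δ' : Fin D → ℂ) (σ : ℂ) (κ : Fin D) :
    invPc a δ δ' σ κ = δ κ * ((a κ)⁻¹ * σ⁻¹ * (hSum a δ δ')⁻¹) := by
  unfold invPc
  rw [div_eq_mul_inv, mul_inv, mul_inv]

/-- [folklore] The `cφ` row in product-of-inverses form. -/
theorem invcP_eq_inv (a δ δ' : Fin D → ℂ) (σ : ℂ) (l : Fin D) :
    invcP a δ δ' σ l = δ' l * ((a l)⁻¹ * σ⁻¹ * (hSum a δ δ')⁻¹) := by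
  unfold invcP
  rw [div_eq_mul_inv, mul_inv, mul_inv]

/-- [folklore] The `cc` corner in product-of-inverses form. -/
theorem invcc_eq_inv (a δ δ' : Fin D → ℂ) (σ : ℂ) :
    invcc a δ δ' σ = (1 / 2) * σ⁻¹ - σ⁻¹ * σ⁻¹ * (hSum a δ δ')⁻¹ := by
  unfold invcc
  rw [one_div, one_div, mul_inv, mul_inv, sq]
  ring

/-- **TWO-LEVEL RATE OF THE `φφ` BLOCK** [folklore]: `‖invPP a' − invPP a‖ ≤ α²ρ + ε²·(2α³ρη + D·ε²·α⁴ρη²)`. -/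
theorem norm_invPP_sub_le (ha : ∀ κ, a κ ≠ 0) (ha' : ∀ κ, a' κ ≠ 0) (hh : hSum a δ δ' ≠ 0) (hh' : hSum a' δ δ' ≠ 0)
    (hα : ∀ κ, ‖(a κ)⁻¹‖ ≤ α) (hα' : ∀ κ, ‖(a' κ)⁻¹‖ ≤ α) (hε : ∀ κ, ‖δ κ‖ ≤ ε) (hε' : ∀ κ, ‖δ' κ‖ ≤ ε)
    (hη : ‖(hSum a δ δ')⁻¹‖ ≤ η) (hη' : ‖(hSum a' δ δ')⁻¹‖ ≤ η) (hρ : ∀ κ, ‖a' κ - a κ‖ ≤ ρ) (κ l : Fin D) :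
    ‖invPP a' δ δ' κ l - invPP a δ δ' κ l‖ ≤ α ^ 2 * ρ + ε ^ 2 * (2 * α ^ 3 * ρ * η + D * ε ^ 2 * α ^ 4 * ρ * η ^ 2) := by
  have hε0 : 0 ≤ ε := (norm_nonneg _).trans (hε κ)
  have hα0 : 0 ≤ α := (norm_nonneg _).trans (hα κ)
  have hdiag := norm_inv_sub_inv_diag_le a a' ha ha' hα hα' hρ
  have h1 : ‖(if κ = l then (a' κ)⁻¹ else (0 : ℂ)) - (if κ = l then (a κ)⁻¹ else 0)‖ ≤ α ^ 2 * ρ := by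
    split_ifs
    · exact hdiag κ
    · rw [sub_zero, norm_zero]; exact le_trans (norm_nonneg _) (hdiag κ)
  have h3 := norm_mul3_sub_le (hα κ) (hα l) (hα' l) hη' (hdiag κ) (hdiag l)
    (norm_inv_hSum_sub_le a a' δ δ' ha ha' hh hh' hα hα' hε hε' hη hη' hρ)
  have h2 : ‖δ κ * δ' l‖ ≤ ε ^ 2 := by
    rw [norm_mul, sq]; exact mul_le_mul (hε κ) (hε' l) (norm_nonneg _) hε0
  rw [invPP_eq_inv, invPP_eq_inv, show ∀ (p' p q' q : ℂ) (w : ℂ), (p' - w * q') - (p - w * q) = (p' - p) - w * (q' - q) from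
    fun _ _ _ _ _ => by ring]
  refine (norm_sub_le _ _).trans (add_le_add h1 ?_)
  rw [norm_mul]
  refine (mul_le_mul h2 h3 (norm_nonneg _) (sq_nonneg _)).trans (le_of_eq ?_)
  ring

/-- **TWO-LEVEL RATE OF THE `φc` COLUMN** [folklore]: `‖invPc' − invPc‖ ≤ ε·(α²ρςη + ας²τη + D·ε²·α³ρςη²)`. -/
theorem norm_invPc_sub_le (ha : ∀ κ, a κ ≠ 0) (ha' : ∀ κ, a' κ ≠ 0) (hσ : σ ≠ 0) (hσ' : σ' ≠ 0) (hh : hSum a δ δ' ≠ 0)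
    (hh' : hSum a' δ δ' ≠ 0) (hα : ∀ κ, ‖(a κ)⁻¹‖ ≤ α) (hα' : ∀ κ, ‖(a' κ)⁻¹‖ ≤ α) (hε : ∀ κ, ‖δ κ‖ ≤ ε) (hε' : ∀ κ, ‖δ' κ‖ ≤ ε)
    (hς : ‖σ⁻¹‖ ≤ ς) (hς' : ‖σ'⁻¹‖ ≤ ς) (hη : ‖(hSum a δ δ')⁻¹‖ ≤ η) (hη' : ‖(hSum a' δ δ')⁻¹‖ ≤ η) (hρ : ∀ κ, ‖a' κ - a κ‖ ≤ ρ)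
    (hτ : ‖σ' - σ‖ ≤ τ) (κ : Fin D) :
    ‖invPc a' δ δ' σ' κ - invPc a δ δ' σ κ‖ ≤ ε * (α ^ 2 * ρ * ς * η + α * ς ^ 2 * τ * η + D * ε ^ 2 * α ^ 3 * ρ * ς * η ^ 2) := by
  have hε0 : 0 ≤ ε := (norm_nonneg _).trans (hε κ)
  have h3 := norm_mul3_sub_le (hα κ) hς hς' hη' (norm_inv_sub_inv_diag_le a a' ha ha' hα hα' hρ κ)
    (norm_inv_sigma_sub_le σ σ' hσ hσ' hς hς' hτ) (norm_inv_hSum_sub_le a a' δ δ' ha ha' hh hh' hα hα' hε hε' hη hη' hρ)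
  rw [invPc_eq_inv, invPc_eq_inv, ← mul_sub, norm_mul]
  refine (mul_le_mul (hε κ) h3 (norm_nonneg _) hε0).trans (le_of_eq ?_)
  ring

/-- **TWO-LEVEL RATE OF THE `cφ` ROW** [folklore]: `‖invcP' − invcP‖ ≤ ε·(α²ρςη + ας²τη + D·ε²·α³ρςη²)`. -/
theorem norm_invcP_sub_le (ha : ∀ κ, a κ ≠ 0) (ha' : ∀ κ, a' κ ≠ 0) (hσ : σ ≠ 0) (hσ' : σ' ≠ 0) (hh : hSum a δ δ' ≠ 0)
    (hh' : hSum a' δ δ' ≠ 0) (hα : ∀ κ, ‖(a κ)⁻¹‖ ≤ α) (hα' : ∀ κ, ‖(a' κ)⁻¹‖ ≤ α) (hε : ∀ κ, ‖δ κ‖ ≤ ε) (hε' : ∀ κ, ‖δ' κ‖ ≤ ε)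
    (hς : ‖σ⁻¹‖ ≤ ς) (hς' : ‖σ'⁻¹‖ ≤ ς) (hη : ‖(hSum a δ δ')⁻¹‖ ≤ η) (hη' : ‖(hSum a' δ δ')⁻¹‖ ≤ η) (hρ : ∀ κ, ‖a' κ - a κ‖ ≤ ρ)
    (hτ : ‖σ' - σ‖ ≤ τ) (l : Fin D) :
    ‖invcP a' δ δ' σ' l - invcP a δ δ' σ l‖ ≤ ε * (α ^ 2 * ρ * ς * η + α * ς ^ 2 * τ * η + D * ε ^ 2 * α ^ 3 * ρ * ς * η ^ 2) := by
  have hε0 : 0 ≤ ε := (norm_nonneg _).trans (hε l)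
  have h3 := norm_mul3_sub_le (hα l) hς hς' hη' (norm_inv_sub_inv_diag_le a a' ha ha' hα hα' hρ l)
    (norm_inv_sigma_sub_le σ σ' hσ hσ' hς hς' hτ) (norm_inv_hSum_sub_le a a' δ δ' ha ha' hh hh' hα hα' hε hε' hη hη' hρ)
  rw [invcP_eq_inv, invcP_eq_inv, ← mul_sub, norm_mul]
  refine (mul_le_mul (hε' l) h3 (norm_nonneg _) hε0).trans (le_of_eq ?_)
  ring

/-- **TWO-LEVEL RATE OF THE `cc` CORNER** [folklore] (no cancellation): `‖invcc' − invcc‖ ≤ ς²τ/2 + 2ς³τη + D·ε²·α²ρς²η²`. -/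
theorem norm_invcc_sub_le (ha : ∀ κ, a κ ≠ 0) (ha' : ∀ κ, a' κ ≠ 0) (hσ : σ ≠ 0) (hσ' : σ' ≠ 0) (hh : hSum a δ δ' ≠ 0)
    (hh' : hSum a' δ δ' ≠ 0) (hα : ∀ κ, ‖(a κ)⁻¹‖ ≤ α) (hα' : ∀ κ, ‖(a' κ)⁻¹‖ ≤ α) (hε : ∀ κ, ‖δ κ‖ ≤ ε) (hε' : ∀ κ, ‖δ' κ‖ ≤ ε)
    (hς : ‖σ⁻¹‖ ≤ ς) (hς' : ‖σ'⁻¹‖ ≤ ς) (hη : ‖(hSum a δ δ')⁻¹‖ ≤ η) (hη' : ‖(hSum a' δ δ')⁻¹‖ ≤ η) (hρ : ∀ κ, ‖a' κ - a κ‖ ≤ ρ)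
    (hτ : ‖σ' - σ‖ ≤ τ) :
    ‖invcc a' δ δ' σ' - invcc a δ δ' σ‖ ≤ ς ^ 2 * τ / 2 + 2 * ς ^ 3 * τ * η + D * ε ^ 2 * α ^ 2 * ρ * ς ^ 2 * η ^ 2 := by
  have hsig := norm_inv_sigma_sub_le σ σ' hσ hσ' hς hς' hτ
  have h3 := norm_mul3_sub_le hς hς hς' hη' hsig hsig (norm_inv_hSum_sub_le a a' δ δ' ha ha' hh hh' hα hα' hε hε' hη hη' hρ)
  rw [invcc_eq_inv, invcc_eq_inv, show ∀ (s' s q' q : ℂ), ((1 / 2 : ℂ) * s' - q') - ((1 / 2) * s - q) = (1 / 2) * (s' - s) - (q' - q) from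
    fun _ _ _ _ => by ring]
  refine (norm_sub_le _ _).trans ?_
  rw [norm_mul, show ‖(1 / 2 : ℂ)‖ = 1 / 2 by norm_num]
  have h1 : 1 / 2 * ‖σ'⁻¹ - σ⁻¹‖ ≤ ς ^ 2 * τ / 2 := by linarith
  refine (add_le_add h1 h3).trans (le_of_eq ?_)
  ring

end abstract

end Summit.QuantumFields.BalabanUV.Beta.GAN24.CapacitanceRate

end
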